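import Mathlib
import Summits.Ventures.DiscreteObjects.Mahler.CensusAuxThresholds
import Summits.Ventures.DiscreteObjects.Mahler.CensusTraceCertificate

/-!
# Extended certificates for the kernel census: trace–Graeffe and certified leaf cuts (venture `DiscreteObjects`, target L)

Cell `pub-namedobj`, seat `pub-namedobj-mahler-g16`. Framing: lottery ticket; floor = certified bounds/negative ranges.

The survivors of the census search `censusSearchC` (monic palindromic `P` of degree `2d` passing the power-sum tests and the
cut table) are discharged by certificates.  `CertX` extends the four certificates of `CensusCertificate` (`cyc`, `red`,
`grf`, `exc`, kept as `CertX.base`) by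
* `CertX.tgr m k` — the TRACE–GRAEFFE rejection certificate of `CensusTraceCertificate` (`Bn/Bd < M(P)`, all arithmetic on the
  degree-`d` trace polynomial; ≈ 3× cheaper in the kernel than `Cert.grf` at degree 20);
* `CertX.cut i` — `P` VIOLATES the certified explicit-auxiliary-function cut number `i` of a table `LC` of leaf cuts
  (`CutValidAL d k B (a, N)`: `0 ≤ N + Σ_j a_j P_j(p)` for every irreducible palindromic `p` of degree `2d` with `M(p) < B`,
  `CensusAuxiliaryLog.acutLog_holds`; the cuts may involve power sums `P_k` with `k > d`, which the search table cannot use),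
  so `P` is reducible or `M(P) ≥ B`.
`certX_verdict` is the soundness of one certificate in verdict form; `census_verdict_nonnegXC` /
`degreeCensus_of_certified_nonnegXC` are the census verdicts of `CensusAuxThresholds` (combined cut table, extended
thresholds, `c₁ ≥ 0` half) with `CertX` certificates.
-/

namespace Summit.Ventures.DiscreteObjects.Mahler

open Polynomial

/-! ## Certificates and their checker -/

/-- Extended certificate for one survivor of the census search. -/
inductive CertX where
  /-- one of the four certificates of `CensusCertificate` -/
  | base (c : Cert)
  /-- trace–Graeffe rejection: `m` Chebyshev–Graeffe steps, coefficient `d - k - 1` (so `Bn/Bd < M(P)`) -/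
  | tgr (m k : ℕ)
  /-- the survivor violates leaf cut number `i` (so it is reducible or `M(P) ≥ Bn/Bd`) -/
  | cut (i : ℕ)

/-- The cut `([a_K, …, a_1], N)` is violated by the monic polynomial with descending tail coefficients `cs`:
`N + Σ_j a_j P_j < 0`. -/
def cutViolated (c : List ℤ × ℤ) (cs : List ℤ) : Bool :=
  decide (c.2 + (List.zipWith (· * ·) c.1 (psumsRev cs c.1.length)).sum < 0)

/-- Check one extended certificate for the ascending list `asc` (monic palindromic of degree `2d`, bound `Bn/Bd`,
exceptions `L`, leaf cuts `LC`). -/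
def checkCertX (Bn Bd d : ℕ) (L : List (List ℤ)) (LC : List (List ℤ × ℤ)) (asc : List ℤ) : CertX → Bool
  | .base c => checkCert Bn Bd (2 * d) L asc c
  | .tgr m k => tgrCheck Bn Bd d m k asc
  | .cut i => decide (i < LC.length) && cutViolated (LC.getD i ([], 0)) asc.tail

/-- All survivors certified, in order (`false` on a length mismatch). -/
def allCertifiedX (Bn Bd d : ℕ) (L : List (List ℤ)) (LC : List (List ℤ × ℤ)) : List (List ℤ) → List CertX → Bool
  | [], [] => true
  | a :: as, c :: cs => checkCertX Bn Bd d L LC (1 :: palC a) c && allCertifiedX Bn Bd d L LC as cs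
  | _, _ => false

/-- `allCertifiedX` gives a valid certificate for every survivor. -/
theorem exists_certX_of_allCertifiedX {Bn Bd d : ℕ} {L : List (List ℤ)} {LC : List (List ℤ × ℤ)} :
    ∀ (S : List (List ℤ)) (C : List CertX), allCertifiedX Bn Bd d L LC S C = true →
      ∀ a ∈ S, ∃ c, checkCertX Bn Bd d L LC (1 :: palC a) c = true := by
  intro S
  induction S with
  | nil => intro C _ a ha; simp at ha
  | cons a as ih =>
    intro C h b hb
    cases C with
    | nil => simp [allCertifiedX] at h
    | cons c cs =>
      simp only [allCertifiedX, Bool.and_eq_true] at h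
      rcases List.mem_cons.mp hb with rfl | hb
      · exact ⟨c, h.1⟩
      · exact ih cs h.2 b hb

/-- A table of leaf cuts is VALID for `(d, B)` if every entry is a certified auxiliary cut of its own length. -/
def LeafCutsValid (d : ℕ) (B : ℝ) (LC : List (List ℤ × ℤ)) : Prop :=
  ∀ c ∈ LC, CutValidAL d c.1.length B c

/-- The empty table is valid. -/
theorem leafCutsValid_nil (d : ℕ) (B : ℝ) : LeafCutsValid d B [] := fun c hc => by simp at hc

/-! ## Soundness of one certificate, in verdict form -/

/-- **Soundness of an extended certificate.** For a monic irreducible palindromic `q` of degree `2d` with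
`1 < M(q) < Bn/Bd`, a valid certificate for `1 :: descCoeffList q` shows that `q` is listed (up to `x ↦ -x`). -/
theorem certX_verdict {Bn Bd d : ℕ} (hBn : 0 < Bn) (hBd : 0 < Bd) {L : List (List ℤ)} {LC : List (List ℤ × ℤ)}
    (hLC : LeafCutsValid d ((Bn : ℝ) / Bd) LC) {q : ℤ[X]} (hqm : q.Monic) (hqd : q.natDegree = 2 * d)
    (hqp : ∀ j ≤ 2 * d, q.coeff j = q.coeff (2 * d - j)) (hqi : Irreducible q) (hq1 : 1 < intMahlerMeasure q)
    (hqB : intMahlerMeasure q < (Bn : ℝ) / Bd) {c : CertX}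
    (hc : checkCertX Bn Bd d L LC (1 :: descCoeffList q) c = true) :
    ∃ l ∈ L, q = ofCoeffs l ∨ q = (ofCoeffs l).comp (-X) := by
  have hp := eq_ofCoeffs_descCoeffList hqm hqd hqp
  cases c with
  | base c =>
    simp only [checkCertX] at hc
    have hmon' : (ofCoeffs (1 :: descCoeffList q)).Monic := by rw [← hp]; exact hqm
    have hdeg' : (ofCoeffs (1 :: descCoeffList q)).natDegree = 2 * d := by rw [← hp]; exact hqd
    have hs := checkCert_sound hBd hc hmon' hdeg'
    rw [← hp] at hs
    rcases hs with h | h | h | h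
    · rw [h] at hq1; exact absurd hq1 (lt_irrefl _)
    · exact absurd hqi h
    · exact absurd hqB (not_lt.mpr h.le)
    · exact h
  | tgr m k =>
    simp only [checkCertX] at hc
    have h := lt_intMahlerMeasure_of_tgrCheck hBn hBd hc
    rw [← hp] at h
    exact absurd hqB (not_lt.mpr h.le)
  | cut i =>
    simp only [checkCertX, Bool.and_eq_true, decide_eq_true_eq, List.tail_cons] at hc
    obtain ⟨hi, hviol⟩ := hc
    set ct := LC.getD i ([], 0) with hct
    have hmem : ct ∈ LC := by rw [hct, List.getD_eq_getElem _ _ hi]; exact List.getElem_mem hi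
    have hvalid := hLC ct hmem
    have hcut := acutLog_holds hqm hqi hqd hqp hqB hvalid
    unfold cutViolated at hviol
    rw [decide_eq_true_eq] at hviol
    exact absurd hcut (not_le.mpr hviol)

/-! ## The verdicts -/

/-- **Census verdict from extended certificates for `c₁ ≥ 0` only (combined cut table, extended thresholds, leaf cuts).** -/
theorem census_verdict_nonnegXC {Bn Bd d : ℕ} {T : List ℕ} {CT : List (List (List ℤ × ℤ))} {L : List (List ℤ)}
    {LC : List (List ℤ × ℤ)} (hBn : 0 < Bn) (hBd : 0 < Bd) (hd : 1 ≤ d) (hdT : d ≤ T.length)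
    (hT : ThresholdsValidX d ((Bn : ℝ) / Bd) T) (hCT : CutTableValidX d ((Bn : ℝ) / Bd) CT)
    (hLC : LeafCutsValid d ((Bn : ℝ) / Bd) LC)
    (hcert : ∀ a ∈ censusSearchC T CT d [] [], 0 ≤ a.getD 0 0 →
      ∃ c, checkCertX Bn Bd d L LC (1 :: palC a) c = true)
    {p : ℤ[X]} (hmonic : p.Monic) (hdeg : p.natDegree = 2 * d)
    (hpal : ∀ j ≤ 2 * d, p.coeff j = p.coeff (2 * d - j)) (hirr : Irreducible p)
    (h1 : 1 < intMahlerMeasure p) (hB : intMahlerMeasure p < (Bn : ℝ) / Bd) :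
    ∃ l ∈ L, p = ofCoeffs l ∨ p = (ofCoeffs l).comp (-X) := by
  have key : ∀ q : ℤ[X], q.Monic → q.natDegree = 2 * d → (∀ j ≤ 2 * d, q.coeff j = q.coeff (2 * d - j)) →
      Irreducible q → 1 < intMahlerMeasure q → intMahlerMeasure q < (Bn : ℝ) / Bd → 0 ≤ q.coeff (2 * d - 1) →
      ∃ l ∈ L, q = ofCoeffs l ∨ q = (ofCoeffs l).comp (-X) := by
    intro q hqm hqd hqp hqi hq1 hqB hq0
    have hmem := take_descCoeffList_mem_censusSearchC_of_irreducibleXT hd hqm hqi hqd hqp hqB hdT hT hCT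
    obtain ⟨c, hc⟩ := hcert _ hmem (by rw [getD_zero_take_descCoeffList hd hqd]; exact hq0)
    rw [palC_take_descCoeffList hd hqm hqd hqp] at hc
    exact certX_verdict hBn hBd hLC hqm hqd hqp hqi hq1 hqB hc
  by_cases h0 : 0 ≤ p.coeff (2 * d - 1)
  · exact key p hmonic hdeg hpal hirr h1 hB h0
  · push Not at h0
    obtain ⟨hqm, hqd, hqp, hqc⟩ := comp_neg_X_palindromic hd hmonic hdeg hpal
    have hq := key (p.comp (-X)) hqm hqd hqp (irreducible_comp_neg_X hirr)
      (by rw [intMahlerMeasure_comp_neg_X]; exact h1) (by rw [intMahlerMeasure_comp_neg_X]; exact hB)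
      (by rw [hqc]; omega)
    obtain ⟨l, hl, h⟩ := hq
    refine ⟨l, hl, ?_⟩
    rcases h with h | h
    · right; rw [← h, comp_neg_X_comp_neg_X]
    · left
      have := congrArg (fun r : ℤ[X] => r.comp (-X)) h
      simpa only [comp_neg_X_comp_neg_X] using this

/-- **From the halved kernel check with extended certificates to a census row** (`B = Bn/Bd ≤ θ₀`). -/
theorem degreeCensus_of_certified_nonnegXC {Bn Bd d : ℕ} {T : List ℕ} {CT : List (List (List ℤ × ℤ))}
    {L : List (List ℤ)} {LC : List (List ℤ × ℤ)} (hBn : 0 < Bn) (hBd : 0 < Bd) (hd : 1 ≤ d) (hdT : d ≤ T.length)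
    (hT : ThresholdsValidX d ((Bn : ℝ) / Bd) T) (hCT : CutTableValidX d ((Bn : ℝ) / Bd) CT)
    (hLC : LeafCutsValid d ((Bn : ℝ) / Bd) LC) (hθ : (Bn : ℝ) / Bd ≤ smythTheta)
    (hcert : ∀ a ∈ censusSearchC T CT d [] [], 0 ≤ a.getD 0 0 →
      ∃ c, checkCertX Bn Bd d L LC (1 :: palC a) c = true) :
    DegreeCensus (2 * d) ((Bn : ℝ) / Bd) L := by
  intro p hdeg hirr h1 h2
  have hrev := (reciprocal_of_measure_lt_smythTheta hirr h1 (lt_of_lt_of_le h2 hθ)).1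
  have hlc : (|p.leadingCoeff| : ℝ) ≤ intMahlerMeasure p := abs_leadingCoeff_le_intMahlerMeasure p
  have hθ2 : smythTheta < 2 := by have := smythTheta_lt; linarith
  have hlc1 : p.leadingCoeff = 1 ∨ p.leadingCoeff = -1 := by
    have hne : p.leadingCoeff ≠ 0 := leadingCoeff_ne_zero.mpr hirr.ne_zero
    have hle : |p.leadingCoeff| ≤ 1 := by
      by_contra h
      push Not at h
      have : (2 : ℝ) ≤ (|p.leadingCoeff| : ℝ) := by
        have : (2 : ℤ) ≤ |p.leadingCoeff| := h
        exact_mod_cast this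
      linarith
    rcases abs_le.mp hle with ⟨h1', h2'⟩
    omega
  obtain ⟨hmonic, hpm, hMm, hdegm, hirrm⟩ := monic_normalisation hlc1
  set q := C p.leadingCoeff * p with hq
  have hrevq : q.reverse = q := by rw [hq, reverse_mul_of_domain, reverse_C, hrev]
  rw [hdeg] at hdegm
  have hpal := palindromic_of_reverse_eq_self q (2 * d) hdegm hrevq
  rw [← hMm] at h1 h2
  obtain ⟨l, hl, hql⟩ := census_verdict_nonnegXC hBn hBd hd hdT hT hCT hLC hcert hmonic hdegm hpal (hirrm hirr) h1 h2
  refine ⟨l, hl, ?_⟩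
  rcases hlc1 with hc | hc
  · have hpq : p = q := by rw [hpm, hc, C_1, one_mul]
    rcases hql with h | h
    · exact Or.inl (hpq.trans h)
    · exact Or.inr (Or.inr (Or.inl (hpq.trans h)))
  · have hpq : p = -q := by
      conv_lhs => rw [hpm, hc]
      simp
    rcases hql with h | h
    · exact Or.inr (Or.inl (by rw [hpq, h]))
    · exact Or.inr (Or.inr (Or.inr (by rw [hpq, h])))

end Summit.Ventures.DiscreteObjects.Mahler
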